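import Mathlib
import Summits.Ventures.PercRepro2.Defs
import Summits.Ventures.PercRepro2.Independence
import Summits.Ventures.PercRepro2.Harris
import Summits.Ventures.PercRepro2.Graph
import Summits.Ventures.PercRepro2.Exploration
import Summits.Ventures.PercRepro2.Events
import Summits.Ventures.PercRepro2.CDRequired
import Summits.Ventures.PercRepro2.CutVertexDefs
import Summits.Ventures.PercRepro2.CDCutVertex
import Summits.Ventures.PercRepro2.CDCutO
import Summits.Ventures.PercRepro2.CDCutAC
import Summits.Ventures.PercRepro2.CDNestedAC
import Summits.Ventures.PercRepro2.CDNestedSimplePaths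
import Summits.Ventures.PercRepro2.CDBlockNested

/-!
# Series composition: row 2′CD on a graph cut by `v` into a nested `a₁`-segment and a nested
`a₃`-segment, for EVERY placement of `a₂` and `o` (blind cell PercRepro2, mine-a g36; MINE-A.md §91.13)

Let `v` be a cut vertex with `a₁` on the near side (or `= v`) and `a₃` on the far side (or `= v`), such
that the simple `a₁–v` paths avoiding `a₂` and the simple `v–a₃` paths avoiding `a₂` have pairwise
comparable vertex sets.  Wherever `a₂` and `o` are, the row holds (`cd_of_series_nested`):

* `a₂, o` both on `a₁`'s side — `CDBlockNested.cd_of_nested_far` (or the nested-paths theorem itself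
  when `a₃ = v`);
* `a₂, o` both on `a₃`'s side — `CDBlockNested.cd_of_nested_root`;
* `a₂` and `o` on different sides — `Q ∩ e ∩ f = ∅`: under `Q` the cut vertex lies in `C₁` as soon as
  `a₁ ↔ a₃`, and an `a₂–o` connection across the cut would put `a₂` there too (`ef_empty_of_cut`,
  `ef_empty_of_cut'`, then `CDCutO.cd_of_ef_empty`).

This is the precise form of the «series composition» remark of proofs/MINEA-CD-NESTED.md §0 (corrected
in §6): such a graph is NOT in the class NEST — the two segments' paths combine into incomparable
`a₁–a₃` paths — but the row holds on it, every up-set, every admissible weight vector.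
No definition; one seat.
-/

namespace Summit.Ventures.PercRepro2

namespace CDSeries

section Empty

variable {V : Type*} {E : Type*} {ends : E → Sym2 V} {z : V} {VA VB : Set V} {EA EB : Set E}
  [DecidablePred (· ∈ EA)] [DecidablePred (· ∈ EB)]

/-- With `a₁, a₂` on the near side and `a₃, o` on the far side (the cut vertex allowed on either),
`Q ∩ {a₁ ↔ a₃} ∩ {a₂ ↔ o}` is empty. -/
lemma ef_empty_of_cut (h : CutV.IsCut ends z VA VB EA EB) {a₁ a₂ a₃ o : V} (ha₁ : a₁ ∈ VA ∪ {z})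
    (ha₂ : a₂ ∈ VA ∪ {z}) (ha₃ : a₃ ∈ VB ∪ {z}) (ho : o ∈ VB ∪ {z}) :
    (connEvent ends a₁ a₂)ᶜ ∩ connEvent ends a₁ a₃ ∩ connEvent ends a₂ o = ∅ := by
  ext ω
  refine ⟨fun hω => ?_, fun hω => hω.elim⟩
  obtain ⟨⟨hQ, h13⟩, h2o⟩ := hω
  rw [mem_connEvent] at h13 h2o
  apply hQ
  show Conn ends ω a₁ a₂
  have h1z : Conn ends ω a₁ z :=
    conn_mono (restrict_le EA ω) ((CDCutVertex.conn_iff_across_or_cut h ha₁ ha₃).mp h13).1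
  have h2z : Conn ends ω a₂ z :=
    conn_mono (restrict_le EA ω) ((CDCutVertex.conn_iff_across_or_cut h ha₂ ho).mp h2o).1
  exact conn_trans h1z (conn_symm h2z)

/-- With `a₁, o` on the near side and `a₂, a₃` on the far side (the cut vertex allowed on either),
`Q ∩ {a₁ ↔ a₃} ∩ {a₂ ↔ o}` is empty. -/
lemma ef_empty_of_cut' (h : CutV.IsCut ends z VA VB EA EB) {a₁ a₂ a₃ o : V} (ha₁ : a₁ ∈ VA ∪ {z})
    (ho : o ∈ VA ∪ {z}) (ha₂ : a₂ ∈ VB ∪ {z}) (ha₃ : a₃ ∈ VB ∪ {z}) :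
    (connEvent ends a₁ a₂)ᶜ ∩ connEvent ends a₁ a₃ ∩ connEvent ends a₂ o = ∅ := by
  ext ω
  refine ⟨fun hω => ?_, fun hω => hω.elim⟩
  obtain ⟨⟨hQ, h13⟩, h2o⟩ := hω
  rw [mem_connEvent] at h13 h2o
  apply hQ
  show Conn ends ω a₁ a₂
  have h1z : Conn ends ω a₁ z :=
    conn_mono (restrict_le EA ω) ((CDCutVertex.conn_iff_across_or_cut h ha₁ ha₃).mp h13).1
  have h2z : Conn ends ω a₂ z :=
    conn_mono (restrict_le EB ω) ((CDCutVertex.conn_iff_across_or_cut h.symm ha₂ ho).mp h2o).1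
  exact conn_trans h1z (conn_symm h2z)

end Empty

section Main

variable {V : Type*} {E : Type*} [Fintype E] [DecidableEq E] [Fintype V] [DecidableEq V]
  {R : Type*} [Field R] [LinearOrder R] [IsStrictOrderedRing R]

variable {ends : E → Sym2 V} {VA VB : Set V} {EA EB : Set E} [DecidablePred (· ∈ EA)]
  [DecidablePred (· ∈ EB)]

/-- **SERIES COMPOSITION.** `v` a cut vertex, `a₁` on the near side (or `= v`), `a₃` on the far side (or
`= v`); the simple `a₁–v` paths avoiding `a₂` pairwise comparable and the simple `v–a₃` paths avoiding
`a₂` pairwise comparable.  Then row 2′CD holds at `(a₁, a₂, a₃, o)` for EVERY placement of `a₂` and `o`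
(on either side or at the cut), every up-set and every admissible weight vector. -/
theorem cd_of_series_nested (p : E → R) (hp : IsProbVec p) (hinj : Function.Injective ends) {v : V}
    (h : CutV.IsCut ends v VA VB EA EB) {a₁ a₂ a₃ o : V} (ha₁ : a₁ ∈ VA ∪ {v})
    (ha₃ : a₃ ∈ VB ∪ {v}) (ha₂ : a₂ ∈ VA ∪ VB ∪ {v}) (ho : o ∈ VA ∪ VB ∪ {v})
    {𝓔 : Set (Set V)} (h𝓔 : IsUpperSet 𝓔)
    (hchainA : ∀ P P' : (openGraph ends (fun _ => true)).Path a₁ v,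
      a₂ ∉ P.1.support → a₂ ∉ P'.1.support →
      P.1.support.toFinset ⊆ P'.1.support.toFinset ∨ P'.1.support.toFinset ⊆ P.1.support.toFinset)
    (hchainB : ∀ P P' : (openGraph ends (fun _ => true)).Path v a₃,
      a₂ ∉ P.1.support → a₂ ∉ P'.1.support →
      P.1.support.toFinset ⊆ P'.1.support.toFinset ∨ P'.1.support.toFinset ⊆ P.1.support.toFinset) :
    let Q := (connEvent ends a₁ a₂)ᶜ
    let U := clusterInEvent ends a₁ 𝓔
    let e := connEvent ends a₁ a₃
    let f := connEvent ends a₂ o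
    let N := (connEvent ends a₁ a₃)ᶜ ∩ (connEvent ends a₂ a₃)ᶜ
    let oU := connEvent ends a₁ o ∪ connEvent ends a₂ o
    prob p (Q ∩ N) * (prob p Q * prob p (Q ∩ U ∩ e ∩ f) - prob p (Q ∩ U) * prob p (Q ∩ e ∩ f)) ≤
      prob p (Q ∩ N ∩ oU) * (prob p Q * prob p (Q ∩ U ∩ e) - prob p (Q ∩ U) * prob p (Q ∩ e)) := by
  -- `a₂` near or far; `o` near or far
  have hsplit : ∀ w, w ∈ VA ∪ VB ∪ {v} → w ∈ VA ∪ {v} ∨ w ∈ VB := by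
    rintro w ((hw | hw) | hw)
    · exact Or.inl (Or.inl hw)
    · exact Or.inr hw
    · exact Or.inl (Or.inr hw)
  rcases hsplit a₂ ha₂ with ha₂n | ha₂f <;> rcases hsplit o ho with hon | hof
  · -- `a₂, o` on `a₁`'s side
    rcases ha₃ with ha₃f | ha₃v
    · exact CDBlockNested.cd_of_nested_far p hp hinj h ha₁ ha₂n hon ha₃f h𝓔 hchainA
    · rw [Set.mem_singleton_iff] at ha₃v
      subst ha₃v
      exact CDNestedSimplePaths.cd_of_nested_simple_paths p hp hinj h𝓔 hchainA
  · -- `a₂` on `a₁`'s side, `o` on `a₃`'s side: trivial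
    exact CDCutO.cd_of_ef_empty p hp ends a₁ a₂ a₃ o h𝓔 (ef_empty_of_cut h ha₁ ha₂n ha₃ (Or.inl hof))
  · -- `a₂` on `a₃`'s side, `o` on `a₁`'s side: trivial
    exact CDCutO.cd_of_ef_empty p hp ends a₁ a₂ a₃ o h𝓔
      (ef_empty_of_cut' h ha₁ hon (Or.inl ha₂f) ha₃)
  · -- `a₂, o` on `a₃`'s side
    exact CDBlockNested.cd_of_nested_root p hp hinj h ha₁ ha₂f hof ha₃ h𝓔 hchainB

end Main

end CDSeries

end Summit.Ventures.PercRepro2
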